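/-
Copyright (c) 2026. All rights reserved.
Released under Apache 2.0 license as described in the file LICENSE.
-/
import Literature.Probability.FitznerVanDerHofstad2017.NobleBoundsNMidSOpen
import HarnessLib

/-!
# Fitzner–van der Hofstad (2017), §6.1 (6.4) / App. B: term-1 packages of a middle junction, variant `F‴`, the two cells `(0, 0, 0)` and `(0, 1, 0)`

[FvdH17] = R. Fitzner, R. van der Hofstad, *Mean-field behavior for nearest-neighbor percolation in `d > 10`*,
arXiv:1506.07977v2 (EJP 22 (2017), paper 43).  Page numbers refer to the arXiv version.

Completion of the exit-class-`0` column of the `F‴` middle junction (kind `midS`, (4.61), p. 41): the cells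
`(a, c, a′) = (0, 0, 0)` and `(0, 1, 0)` left aside by `NobleBoundsNMidSZero` / `NobleBoundsNMidSOne` (there
`a ∈ {1, 2}`), i.e. lower exit class `a = 0` (`w_k = u_k`, [FvdH17] §6.1 "Case a = 0", p. 58: the exit line of level
`k` starts at the vacant vertex `u_k`, so `{z_k ←1→ u_k}`), upper exit class `a′ = 0` (`w_{k+1} = u_{k+1}`), inner
class `c = 0` (`t_k = z_k`) resp. `c = 1` (`(t_k, z_k)` an open bond of `ω_{k+1}`).  Targets: the `c`-summands
`A'^{κ,0,0,*}(u,u,t,t) · A^{0,0}(t,t,w′,w′)` and `A^{κ,0,1,*}(u,u,t,z) · A^{1,0}(t,z,w′,w′)` of the first term of the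
pointwise (5.4) (p. 48); the row `(0,0)` of `A^{ι,a,b,*}` in the §6.1 reading `T_{1̲,1,1}(e,x,0)` (PRIMED family
`blockAiotaSt'`, DIVERGENCE D74 (i) of the b2b-lace packet; App. B p. 75 prints `T_{1,1̲,1}`), the row `(0,1)` with
its two summands `δ_{x,e} T*_{1̲,1̲,2}(e,y,0) + S*_{1̲,1,1̲,1}(e,x,y,0)` (sub-rows `t = b̄_k`: exit leg of length `≥ 2`
by parity; `t ≠ b̄_k`).  The letter inequalities are those of `NobleBoundsNMidSOpen` (§A there) and of
`NobleBoundsNMidSZero` / `NobleBoundsNMidSOne` (`A^{0,0} = ℙ(t ⇔ w′)`, `A^{1,0} = 2dD(z−t) 𝓑_{1,1}`); the package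
is the core `nonempty_jPkg_midSOpen_core` (grouping `glMidS12`) with the two-line reading of the exit letter.

Conventions: `d`-generic; nothing is cited as a fact; additive (no existing declaration is changed).  The
junction is written `k = i.castSucc = i₀.succ` (`i i₀ : Fin (M+1)`), as in `NobleBoundsNMidS`.
-/

noncomputable section

namespace Literature.Probability.FitznerVanDerHofstad2017

open Literature.Barriers.CriticalPhenomena Literature.Probability.Percolation
open Literature.Probability.LatticeModels Literature.Combinatorics.SimpleGraph _root_.SimpleGraph
open _root_.MeasureTheory
open Literature.Probability.FitznerVanDerHofstad2017.NobleBlocks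
open Literature.Probability.FitznerVanDerHofstad2017.NobleBlocks.LenIdx
open scoped ENNReal

variable {d : ℕ}

section Letter

variable (p : unitInterval) (M : ℕ) (x : Site d) (b : Fin (M + 2) → Site d × Site d) (w t z : Fin (M + 2) → Site d)
  (a : Fin (M + 2) → Fin 3 ⊕ Unit) (τ : Fin (M + 1) → Bool × Fin 3)

/-- **Two-line reading of the letter `up 2`** under `glMidS12`, exit leg dropped (exit class `0` above: the leg
`w′ → u′` is trivial): `t → w′` (slot 2), `u′ → z` (slot 3, read backwards), both on level `k + 1`.
[cite: FitznerVanDerHofstad2017, §4.2 (4.16) (arXiv:1506.07977v2 p. 36); §6.1 (6.4) (p. 58)] -/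
theorem junF_midSOpen_up_le₂ (i : Fin (M + 1)) (hσ : (τ i).1 = false) {a' : Fin 3} (ha' : a i.succ = Sum.inl a')
    (EB E0 E1 E2 E3 E4 X5 : Set (BondConfig (Site d))) :
    junF p M x b w t z a τ i.castSucc glMidS12 true false (midEv EB E0 E1 E2 E3 E4 X5) (.up 2) ≤
      piPerc d p 2 (genDisjOcc ![E2, E3] ![1, 1]) := by
  refine junF_le_of_lines p M x b w t z a τ i.castSucc glMidS12 true false _ (JIdx.up 2)
    ![JIdx.up 2, .up 3] (by decide) (fun m => ?_) ![1, 1] (fun m => by fin_cases m <;> rfl)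
    ![E2, E3] (by funext m; fin_cases m <;> rfl)
  fin_cases m
  · exact ⟨(jMidS_act_up_iff M x b w t z a τ i hσ ha' true false 2).2 (by decide), rfl⟩
  · exact ⟨(jMidS_act_up_iff M x b w t z a τ i hσ ha' true false 3).2 (by decide), rfl⟩

end Letter

section Packages

variable (p : unitInterval) (M : ℕ) (x : Site d) (b : Fin (M + 2) → Site d × Site d) (w t z : Fin (M + 2) → Site d)
  (a : Fin (M + 2) → Fin 3 ⊕ Unit) (c : Fin 3 ⊕ Unit) (τ : Fin (M + 1) → Bool × Fin 3)

/-- **Cell `(0, 0, 0)`, variant `F‴`, of a middle junction `k = i₀ + 1 ≤ M`**, primed entry letter: a package with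
target `A'^{κ,0,0,*}(u_k,w_k,t_k,z_k) · A^{0,0}(t_k,z_k,w_{k+1},u_{k+1})` = the `c = 0` summand of the first term of
(5.4).  Exit class `0` below (`w_k = u_k`): the exit line is `{t_k = z_k ←1→ u_k}`; inner class `0` (`t = z`) and the
entry line `{b̄_k ←1→ t}` (`b̄_k ≠ z_k`) make the entry letter the §6.1 triangle `T_{1̲,1,1}(e, t−u, 0)`; exit class
`0` above makes the exit letter the double connection `ℙ(t ⇔ w′)`.
[cite: FitznerVanDerHofstad2017, §6.1 (6.4), "Case a = 0 and b = 0" (arXiv:1506.07977v2 pp. 58–59); §5.1 (5.4) (p. 48); App. B (pp. 74–75)] -/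
theorem nonempty_jPkg_midS_zero_zero_zero' (i i₀ : Fin (M + 1)) (hk : i₀.succ = i.castSucc) (κ : Fin d × Bool)
    (hb : (b i.castSucc).2 = (b i.castSucc).1 + stepVec κ) (hσ : (τ i).1 = false) (hc0 : (τ i).2 = 0)
    (ha : a i.castSucc = Sum.inl 0) (ha' : a i.succ = Sum.inl 0) :
    Nonempty (JPkg p (jctx M x b w t z a τ i.castSucc) (JFacts M x b w t z a c τ)
      (blockAiotaSt' (Letters.perc d p) κ 0 0 (b i.castSucc).1 (w i.castSucc) (t i.castSucc) (z i.castSucc) *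
        blockA (Letters.perc d p) 0 0 (t i.castSucc) (z i.castSucc) (w i.succ) (b i.succ).1)) := by
  -- degenerate parameters: the piece is empty
  by_cases hP : z i.castSucc = t i.castSucc ∧ w i.succ = (b i.succ).1 ∧ t i.castSucc ≠ (b i.succ).1 ∧
      (b i.castSucc).1 ≠ t i.castSucc ∧ (b i.castSucc).2 ≠ z i.castSucc ∧ w i.castSucc = (b i.castSucc).1
  swap
  · refine ⟨JPkg.vacuous p _ _ (fun ω K₀ hF => hP ?_) _⟩
    have hv := hF.vac_midS i hσ ha'
    exact ⟨(hF.t_eq_z_of_innerClass_zero i hc0).symm, hF.w_eq_of_exitClass_zero i.succ ha',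
      (hF.canon_midS i hσ ha').2, fun h => hv (by simp [h]), hF.v_ne_z_of_open i i₀ hk ha,
      hF.w_eq_of_exitClass_zero i.castSucc ha⟩
  obtain ⟨hzt, hwy, hty, hut, hvz, hwu⟩ := hP
  have hvt : (b i.castSucc).2 ≠ t i.castSucc := by rw [← hzt]; exact hvz
  rw [hwy, hzt, hwu]
  have h := nonempty_jPkg_midSOpen_core p M x b w t z a τ c i i₀ hk κ hb hσ ha ha'
    (event (ge 1) (b i.castSucc).2 (t i.castSucc)) Set.univ (event (ge 0) (t i.castSucc) (b i.succ).1)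
    (event (ge 0) (t i.castSucc) (b i.succ).1) Set.univ (event (ge 1) (t i.castSucc) (b i.castSucc).1)
    (isFinitary_event _ _ _) isFinitary_univ (isFinitary_event _ _ _) (isFinitary_event _ _ _) isFinitary_univ
    (isFinitary_event _ _ _) (fun ω K₀ hF => ?_)
    (T₁ := blockAiotaSt' (Letters.perc d p) κ 0 0 (b i.castSucc).1 (b i.castSucc).1 (t i.castSucc) (t i.castSucc))
    (T₂ := blockA (Letters.perc d p) 0 0 (t i.castSucc) (t i.castSucc) (b i.succ).1 (b i.succ).1) ?_ ?_
  · exact h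
  · obtain ⟨h0, -, h2, h3, -⟩ := hF.conn_midS i hσ ha'
    rw [hwy] at h2
    rw [hzt] at h3
    have h5 := hF.conn_exit i i₀ hk ha
    rw [hzt, hwu] at h5
    refine ⟨?_, Set.mem_univ _, ?_, ?_, Set.mem_univ _, ?_⟩
    · rw [event_ge]; exact mem_openConnGe_one_of_ne h0 hvt
    · rw [event_ge]; exact mem_openConnGe_zero_of_mem h2
    · rw [event_ge]; exact mem_openConnGe_zero_of_mem h3
    · rw [event_comm, event_ge]; exact mem_openConnGe_one_of_ne h5 hut
  · refine (junF_midSOpen_xb_le₃ p M x b w t z a τ i i₀ hk hσ ha ha' _ _ _ _ _ _ _).trans ?_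
    exact piPerc_midS_zero_zero_le_blockAiotaSt' p hb hvt.symm (fun h => hut h.symm) _
  · refine (junF_midSOpen_up_le₂ p M x b w t z a τ i hσ ha' _ _ _ _ _ _ _).trans ?_
    exact piPerc_midS_zero_zero_le_blockA p hty _ rfl

/-- **Cell `(0, 1, 0)`, variant `F‴`, of a middle junction `k = i₀ + 1 ≤ M`**: a package with target
`A^{κ,0,1,*}(u_k,w_k,t_k,z_k) · A^{1,0}(t_k,z_k,w_{k+1},u_{k+1})` = the `c = 1` summand of the first term of (5.4).
Exit class `0` below (`w_k = u_k`), inner class `1` (the sausage line of level `k + 1` is the open bond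
`{t ←1̲→ z}` itself, `Conds.tzNF`), exit class `0` above (`w′ = u′`: exit letter `2dD(z−t) 𝓑_{1,1}(w′−t, z−t)`);
the two-summand row `(0,1)` of `A^{ι,a,b,*}` is met in its sub-rows `t = b̄_k` (triangle `T*_{1̲,1̲,2}`, exit leg of
length `≥ 2` by parity) and `t ≠ b̄_k` (square `S*_{1̲,1,1̲,1}`).
[cite: FitznerVanDerHofstad2017, §6.1 (6.4), "Case a = 0", "Case b = 1" (arXiv:1506.07977v2 pp. 58–59); §5.1 (5.4) (p. 48); App. B (pp. 74–75)] -/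
theorem nonempty_jPkg_midS_zero_one_zero (i i₀ : Fin (M + 1)) (hk : i₀.succ = i.castSucc) (κ : Fin d × Bool)
    (hb : (b i.castSucc).2 = (b i.castSucc).1 + stepVec κ) (hσ : (τ i).1 = false) (hc1 : (τ i).2 = 1)
    (ha : a i.castSucc = Sum.inl 0) (ha' : a i.succ = Sum.inl 0) :
    Nonempty (JPkg p (jctx M x b w t z a τ i.castSucc) (JFacts M x b w t z a c τ)
      (blockAiotaSt (Letters.perc d p) κ 0 1 (b i.castSucc).1 (w i.castSucc) (t i.castSucc) (z i.castSucc) *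
        blockA (Letters.perc d p) 1 0 (t i.castSucc) (z i.castSucc) (w i.succ) (b i.succ).1)) := by
  -- degenerate parameters: the piece is empty
  by_cases hP : (zdGraph d).Adj (t i.castSucc) (z i.castSucc) ∧ w i.succ = (b i.succ).1 ∧
      t i.castSucc ≠ (b i.succ).1 ∧ z i.castSucc ≠ (b i.succ).1 ∧ (b i.castSucc).1 ≠ z i.castSucc ∧
      w i.castSucc = (b i.castSucc).1
  swap
  · refine ⟨JPkg.vacuous p _ _ (fun ω K₀ hF => hP ?_) _⟩
    have hv := hF.vac_midS i hσ ha'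
    exact ⟨(hF.innerClass_one i hc1).2.2, hF.w_eq_of_exitClass_zero i.succ ha', (hF.canon_midS i hσ ha').2,
      (hF.canon_midS i hσ ha').1, fun h => hv (by simp [h]), hF.w_eq_of_exitClass_zero i.castSucc ha⟩
  obtain ⟨hadj, hwy, hty, hzy, huz, hwu⟩ := hP
  have htz : t i.castSucc ≠ z i.castSucc := hadj.ne
  obtain ⟨κ', hκ'⟩ := (zdGraph_adj_iff_stepVec _ _).1 hadj
  -- the open sausage bond is its own witness
  have hbond : ∀ ω K₀, JFacts M x b w t z a c τ ω K₀ →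
      K₀ i.castSucc.succ 1 ∈ (event (eq 1) (t i.castSucc) (z i.castSucc) : Set (BondConfig (Site d))) := by
    intro ω K₀ hF
    rw [hF.tz_witness_midS i hσ ha' htz (hF.innerClass_one i hc1).2.1]
    exact singleton_mem_event_eq_one htz
  -- the exit letter `A^{1,0}`: `t → w′`, `w′ → z`
  have hexit : ∀ ω K₀, JFacts M x b w t z a c τ ω K₀ →
      K₀ i.castSucc.succ 2 ∈ (event (ge 1) (t i.castSucc) (b i.succ).1 : Set (BondConfig (Site d))) ∧
        K₀ i.castSucc.succ 3 ∈ (event (ge 1) (b i.succ).1 (z i.castSucc) : Set (BondConfig (Site d))) := by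
    intro ω K₀ hF
    obtain ⟨-, -, h2, h3, -⟩ := hF.conn_midS i hσ ha'
    rw [hwy] at h2
    refine ⟨?_, ?_⟩
    · rw [event_ge]; exact mem_openConnGe_one_of_ne h2 hty
    · rw [event_comm, event_ge]; exact mem_openConnGe_one_of_ne h3 hzy
  rw [hwy, hwu]
  by_cases hx : t i.castSucc = (b i.castSucc).2
  · -- sub-row `x = e`: triangle, exit leg of length `≥ 2` by parity
    have h := nonempty_jPkg_midSOpen_core p M x b w t z a τ c i i₀ hk κ hb hσ ha ha' Set.univ
      (event (eq 1) (t i.castSucc) (z i.castSucc)) (event (ge 1) (t i.castSucc) (b i.succ).1)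
      (event (ge 1) (b i.succ).1 (z i.castSucc)) Set.univ (event (ge 2) (z i.castSucc) (b i.castSucc).1)
      isFinitary_univ (isFinitary_event _ _ _) (isFinitary_event _ _ _) (isFinitary_event _ _ _) isFinitary_univ
      (isFinitary_event _ _ _) (fun ω K₀ hF => ?_)
      (T₁ := blockAiotaSt (Letters.perc d p) κ 0 1 (b i.castSucc).1 (b i.castSucc).1 (t i.castSucc) (z i.castSucc))
      (T₂ := blockA (Letters.perc d p) 1 0 (t i.castSucc) (z i.castSucc) (b i.succ).1 (b i.succ).1) ?_ ?_
    · exact h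
    · have h5 := hF.conn_exit i i₀ hk ha
      rw [hwu] at h5
      have hadj' : (zdGraph d).Adj (b i.castSucc).1 (b i.castSucc).2 := (zdGraph_adj_iff_stepVec _ _).2 ⟨κ, hb⟩
      have hna : ¬ (zdGraph d).Adj (b i.castSucc).1 (z i.castSucc) :=
        not_adj_of_adj_adj hadj' (by rw [← hx]; exact hadj)
      refine ⟨Set.mem_univ _, hbond ω K₀ hF, (hexit ω K₀ hF).1, (hexit ω K₀ hF).2, Set.mem_univ _, ?_⟩
      rw [event_comm, event_ge]
      refine mem_openConnGe_two_of_notMem h5 huz fun hm => hna ?_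
      exact (SimpleGraph.mem_edgeSet _).1 (hF.lattice _ (hF.witness_subset _ 5 hm))
    · refine (junF_midSOpen_xb_le₃' p M x b w t z a τ i i₀ hk hσ ha ha' _ _ _ _ _ _ _).trans ?_
      rw [hx]
      exact piPerc_midS_zero_one_e_le_blockAiotaSt p hb (fun h => huz h.symm) _
    · refine (junF_midSOpen_up_le₂ p M x b w t z a τ i hσ ha' _ _ _ _ _ _ _).trans ?_
      exact piPerc_midS_one_zero_le_blockA p hκ' _
  · -- sub-row `x ≠ e`: square
    have h := nonempty_jPkg_midSOpen_core p M x b w t z a τ c i i₀ hk κ hb hσ ha ha'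
      (event (ge 1) (b i.castSucc).2 (t i.castSucc)) (event (eq 1) (t i.castSucc) (z i.castSucc))
      (event (ge 1) (t i.castSucc) (b i.succ).1) (event (ge 1) (b i.succ).1 (z i.castSucc)) Set.univ
      (event (ge 1) (z i.castSucc) (b i.castSucc).1)
      (isFinitary_event _ _ _) (isFinitary_event _ _ _) (isFinitary_event _ _ _) (isFinitary_event _ _ _)
      isFinitary_univ (isFinitary_event _ _ _) (fun ω K₀ hF => ?_)
      (T₁ := blockAiotaSt (Letters.perc d p) κ 0 1 (b i.castSucc).1 (b i.castSucc).1 (t i.castSucc) (z i.castSucc))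
      (T₂ := blockA (Letters.perc d p) 1 0 (t i.castSucc) (z i.castSucc) (b i.succ).1 (b i.succ).1) ?_ ?_
    · exact h
    · obtain ⟨h0, -⟩ := hF.conn_midS i hσ ha'
      have h5 := hF.conn_exit i i₀ hk ha
      rw [hwu] at h5
      refine ⟨?_, hbond ω K₀ hF, (hexit ω K₀ hF).1, (hexit ω K₀ hF).2, Set.mem_univ _, ?_⟩
      · rw [event_ge]; exact mem_openConnGe_one_of_ne h0 (fun h => hx h.symm)
      · rw [event_comm, event_ge]; exact mem_openConnGe_one_of_ne h5 huz
    · refine (junF_midSOpen_xb_le₄ p M x b w t z a τ i i₀ hk hσ ha ha' _ _ _ _ _ _ _).trans ?_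
      exact piPerc_midS_zero_one_ne_le_blockAiotaSt p hb (fun h => huz h.symm) _
    · refine (junF_midSOpen_up_le₂ p M x b w t z a τ i hσ ha' _ _ _ _ _ _ _).trans ?_
      exact piPerc_midS_one_zero_le_blockA p hκ' _

end Packages

end Literature.Probability.FitznerVanDerHofstad2017

end
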